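import Literature.AlgebraicGeometry.Resolution.ExtAnnihilatorIndependence
import Literature.AlgebraicGeometry.Resolution.ExtAnnihilatorLocalizationEq
import HarnessLib

/-!
# The canonical `Ext`-annihilator ideal of a finite module and its behaviour on overlapping charts

Topic: `Literature/AlgebraicGeometry/Resolution` (globalization step of Kawasaki's
Macaulayfication, Kawasaki 2000, Lemma 5.3: the annihilator ideals `𝔞(·)` of the affine pieces of
a projective scheme have to be compared on the overlaps of the standard charts).

For a Noetherian ring `B`, a finite `B`-module `M` and a window `T ⊂ ℕ` we fix
`extAnn B M T = ∏_{q ∈ T} Ann_B E^q(F)` for the canonical finite free resolution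
`F = FreeResolution.ofNoetherian M` (`E^q(F)` the syzygy presentation of `Ext^q_B(M, B)`,
`Literature/…/SyzygyStaircase`); by `FreeResolution.prod_annihilator_EMod_eq` any resolution gives
the same ideal (`extAnn_eq`), so

* `extAnn_congr` — it only depends on the isomorphism class of `M`;
* `extAnn_map_of_isLocalization` — it localizes: `extAnn B M T · B_S = extAnn B_S M_S T` for any
  models `B_S`, `M_S` of the localizations (`FreeResolution.prod_annihilator_EMod_baseChange_eq`);
* `extAnn_map_eq_of_isLocalization₂` — **two-chart compatibility**: if `C` is a localization of
  both `B₁` and `B₂` and the `C`-module `N` is the base change of both `M₁` and `M₂`, then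
  `extAnn B₁ M₁ T · C = extAnn B₂ M₂ T · C` (both are `extAnn C N T`).

Everything is proved; no named facts. [cite: Matsumura1987, Appendix B, p. 282 (independence of
the resolution); Kawasaki2000, proof of La. 5.3]
-/

noncomputable section

open Module

universe u

namespace Literature.AlgebraicGeometry.Resolution

variable (B : Type u) [CommRing B] [IsNoetherianRing B] (M : Type u) [AddCommGroup M] [Module B M]
  [Module.Finite B M]

/-- **The `Ext`-annihilator ideal of a finite module over a Noetherian ring** for the window `T`:
`∏_{q ∈ T} Ann_B E^q(F)` for the canonical finite free resolution `F` of `M`.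
[cite: Kawasaki2000, Def. 2.1 (the ideal 𝔞(M), Ext form)] -/
def extAnn (T : Finset ℕ) : Ideal B :=
  ∏ q ∈ T, Module.annihilator B ((FreeResolution.ofNoetherian (R := B) M).EMod q)

variable {B M}

/-- `extAnn` may be computed with any finite free resolution. [cite: Matsumura1987, Appendix B] -/
theorem extAnn_eq (F : FreeResolution B M) (T : Finset ℕ) :
    extAnn B M T = ∏ q ∈ T, Module.annihilator B (F.EMod q) :=
  FreeResolution.prod_annihilator_EMod_eq _ F T

/-- `extAnn` (positive window) is invariant under isomorphisms of the module. [folklore] -/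
theorem extAnn_congr {M' : Type u} [AddCommGroup M'] [Module B M'] [Module.Finite B M']
    (e : M ≃ₗ[B] M') (T : Finset ℕ) (hT : ∀ q ∈ T, 1 ≤ q) : extAnn B M T = extAnn B M' T := by
  rw [extAnn_eq ((FreeResolution.ofNoetherian (R := B) M).congr e) T, extAnn]
  refine Finset.prod_congr rfl fun q hq => ?_
  obtain ⟨q', rfl⟩ : ∃ q', q = q' + 1 := ⟨q - 1, by have := hT q hq; omega⟩
  rfl

/-- **`extAnn` localizes**: for a localization `B_S` of `B` and a model `φ : M → M'` of the base
change of `M` to `B_S`, `extAnn B M T · B_S = extAnn B_S M' T` (positive window).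
[cite: Matsumura1987, §19 Lemma 4] -/
theorem extAnn_map_of_isLocalization (S : Submonoid B) (Bₛ : Type u) [CommRing Bₛ] [Algebra B Bₛ]
    [IsLocalization S Bₛ] [IsNoetherianRing Bₛ] {M' : Type u} [AddCommGroup M'] [Module B M']
    [Module Bₛ M'] [IsScalarTower B Bₛ M'] [Module.Finite Bₛ M'] (φ : M →ₗ[B] M')
    (hφ : IsBaseChange Bₛ φ) (T : Finset ℕ) (hT : ∀ q ∈ T, 1 ≤ q) :
    (extAnn B M T).map (algebraMap B Bₛ) = extAnn Bₛ M' T := by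
  haveI : Module.Flat B Bₛ := IsLocalization.flat Bₛ S
  rw [extAnn, ← (FreeResolution.ofNoetherian (R := B) M).prod_annihilator_EMod_baseChange_eq S Bₛ φ hφ
    T hT, extAnn_eq ((FreeResolution.ofNoetherian (R := B) M).baseChange Bₛ φ hφ) T]

/-- **Two-chart compatibility of `extAnn`.** If `C` is a localization of `B₁` at `S₁` and of `B₂`
at `S₂`, and the finite `C`-module `N` is the base change of the `B₁`-module `M₁` and of the
`B₂`-module `M₂`, then the extensions to `C` of `extAnn B₁ M₁ T` and `extAnn B₂ M₂ T` coincide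
(both equal `extAnn C N T`) — the comparison of Kawasaki's annihilator ideals of two affine charts
on their overlap. [cite: Kawasaki2000, proof of La. 5.3] -/
theorem extAnn_map_eq_of_isLocalization₂ {B₁ B₂ C : Type u} [CommRing B₁] [IsNoetherianRing B₁]
    [CommRing B₂] [IsNoetherianRing B₂] [CommRing C] [IsNoetherianRing C] [Algebra B₁ C]
    [Algebra B₂ C] (S₁ : Submonoid B₁) (S₂ : Submonoid B₂) [IsLocalization S₁ C]
    [IsLocalization S₂ C] {M₁ M₂ N : Type u} [AddCommGroup M₁] [Module B₁ M₁] [Module.Finite B₁ M₁]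
    [AddCommGroup M₂] [Module B₂ M₂] [Module.Finite B₂ M₂] [AddCommGroup N] [Module C N]
    [Module.Finite C N] [Module B₁ N] [IsScalarTower B₁ C N] [Module B₂ N] [IsScalarTower B₂ C N]
    (φ₁ : M₁ →ₗ[B₁] N) (hφ₁ : IsBaseChange C φ₁) (φ₂ : M₂ →ₗ[B₂] N) (hφ₂ : IsBaseChange C φ₂)
    (T : Finset ℕ) (hT : ∀ q ∈ T, 1 ≤ q) :
    (extAnn B₁ M₁ T).map (algebraMap B₁ C) = (extAnn B₂ M₂ T).map (algebraMap B₂ C) := by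
  rw [extAnn_map_of_isLocalization S₁ C φ₁ hφ₁ T hT, extAnn_map_of_isLocalization S₂ C φ₂ hφ₂ T hT]

/-- **Clearing denominators on the second chart**: in the two-chart situation, for every
`c ∈ extAnn B₁ M₁ T` there are `s ∈ S₂` and `c' ∈ extAnn B₂ M₂ T` with `c · 1 = c' / s` in `C`,
i.e. `s • c = c'` in `C`. [cite: Kawasaki2000, proof of La. 5.3] -/
theorem exists_smul_mem_of_mem_extAnn₂ {B₁ B₂ C : Type u} [CommRing B₁] [IsNoetherianRing B₁]
    [CommRing B₂] [IsNoetherianRing B₂] [CommRing C] [IsNoetherianRing C] [Algebra B₁ C]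
    [Algebra B₂ C] (S₁ : Submonoid B₁) (S₂ : Submonoid B₂) [IsLocalization S₁ C]
    [IsLocalization S₂ C] {M₁ M₂ N : Type u} [AddCommGroup M₁] [Module B₁ M₁] [Module.Finite B₁ M₁]
    [AddCommGroup M₂] [Module B₂ M₂] [Module.Finite B₂ M₂] [AddCommGroup N] [Module C N]
    [Module.Finite C N] [Module B₁ N] [IsScalarTower B₁ C N] [Module B₂ N] [IsScalarTower B₂ C N]
    (φ₁ : M₁ →ₗ[B₁] N) (hφ₁ : IsBaseChange C φ₁) (φ₂ : M₂ →ₗ[B₂] N) (hφ₂ : IsBaseChange C φ₂)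
    (T : Finset ℕ) (hT : ∀ q ∈ T, 1 ≤ q) {c : B₁} (hc : c ∈ extAnn B₁ M₁ T) :
    ∃ (s : S₂) (c' : B₂), c' ∈ extAnn B₂ M₂ T ∧
      algebraMap B₂ C s * algebraMap B₁ C c = algebraMap B₂ C c' := by
  have hmem : algebraMap B₁ C c ∈ (extAnn B₂ M₂ T).map (algebraMap B₂ C) := by
    rw [← extAnn_map_eq_of_isLocalization₂ S₁ S₂ φ₁ hφ₁ φ₂ hφ₂ T hT]
    exact Ideal.mem_map_of_mem _ hc
  rw [IsLocalization.mem_map_algebraMap_iff S₂ C] at hmem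
  obtain ⟨⟨⟨c', hc'⟩, s⟩, h⟩ := hmem
  exact ⟨s, c', hc', by simpa [mul_comm] using h⟩

end Literature.AlgebraicGeometry.Resolution

end
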